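import Summits.BirchSwinnertonDyer.BirchSwinnertonDyer.Theorems.SchneiderFreeAdditiveX3AnticycControlAdditiveOfTorsAtoms
import HarnessLib

/-!
# Crux `PrintCf2.SplitBadTwoRankOneOfFacts` (item 20368), line `eisenstein_two_bdp_line` (skeleton of record 859a52ca) — D2a LOCALISED:
# the registered `stub_control_two` (control at `T = 0` with net correction `+1`) follows from cell bsd-schneider's torsion-robust ATOMS
# with the base Selmer count corrected by the SAME `+1`; every other atom and the counting glue are prime-free

Cell `bsd-print-cf2`, seat `bsd-line-cf2-p1-w2` (prover, width seat on crux stmt-BirchSwinnertonDyer-20368; lead `bsd-line-cf2-p1`). `--supports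
stmt-BirchSwinnertonDyer-20368` (helper). THEOREMS ONLY (0 definitions, 0 named facts, 0 `sorry`); CONDITIONAL on the displayed atoms (hypotheses
on cardinalities of tree objects); BSD is proved for no curve by any of this; no summit statement is proved by this seat.

WHAT THIS IS. Cell bsd-schneider's `SchneiderFreeAdditiveX3.additiveControlOnTreeAt_of_torsAtoms` (any `p`) glues the exact counting snake lemma
`#Sel^γ · #ker res = #Sel_𝔭(K) · #ker r_𝔭 · ∏_{Σ(N⁺)} #ker r_w` (kernel theorem `natCard_endInvariants_mul_natCard_resKer_eq_nPlus`) with the atoms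
(KER-res) `#ker res = p^g`, (KER-𝔭) `#ker r_𝔭 = p^t`, (P6-add-tors) `#Sel_𝔭(K, E[p^∞]) = p^a`, `a = ord_p #Ш + 2(ord_p log_ω P − ord_p idx) +
ord_p ∏_{w∣p} c_w + g − t`, (P9-𝓒), (L10), (P11) into the odd-`p` socket `SchneiderFree.AdditiveControlOnTreeAt` (net correction `τ = 0`). On THIS
line the socket at `2` must carry `τ = 1` (`PrintCf2SplitBadEisensteinTwoDescentCore`, `…OddSocketObstruction`: `τ = 0` is refuted under stubs 1+2+3
and `BSD₂` of the pair), and the LEAD registered `stub_control_two` with `+1`. THIS FILE re-runs the glue with the base count's correction as a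
PARAMETER `τ : ℤ`:
* `hasCharValuationAt_of_torsAtoms_corr` (every `p`, every `τ`): atoms with (P6-add-tors)_τ `a = … + g − t + τ` ⟹
  `∃ n, XAc.HasCharValuationAt … n ∧ n = ord_p #Ш + 2(ord_p log_ω P − ord_p idx) + ord_p ∏_{w∣N⁺} c_w + τ` — the control exponent's correction IS the
  base count's correction (`τ = 0` is bsd-schneider's theorem);
* **`controlTwo_of_torsAtoms`** (`p = 2`, `τ = 1`): the conclusion of the registered `stub_control_two` at one frame from the atoms with the base
  count `a = ord₂ #Ш(E_K)[2^∞] + 2(ord₂ log_ω P − ord₂ [E(K):ℤP]) + ord₂ ∏_{w∣2} c_w(E_K) + g − t + 1`.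
So D2a is LOCALISED to ONE statement with no Iwasawa theory in it: the order of Castella's base Selmer group `Sel_𝔭′(K″, W[2^∞])` of `49a1^{(d)}`
over a `2`-split Heegner field — JSW17 Prop. 3.2.1 at `p = 2` with the `2`-adic local index at `v ∣ 2` (`E₁(ℚ₂)/E₂(ℚ₂) ≅ 𝔽₂`,
`log_ω(E₂(ℚ₂)) = 4ℤ₂`, `W(ℚ₂)[2] = (ℤ/2)²`) producing exactly one extra factor `2` relative to the odd-`p` count. Nothing here asserts that count.

References: [JetchevSkinnerWan2017] Thm. 3.3.1, Prop. 3.2.1, §3.3.4; [Castella2018] Thm. 2.3; [GreenbergLNM1716] §3–§4; [SilvermanAEC2009] IV.6.4.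
-/

noncomputable section

open scoped Classical

open WeierstrassCurve NumberField IsDedekindDomain Field Literature.NumberTheory.EllipticCurves
  Literature.NumberTheory.EllipticCurves.ModularForms
  Literature.NumberTheory.EllipticCurves.GreenbergSelmer
  Literature.NumberTheory.GaloisRepresentations
  Literature.NumberTheory.EllipticCurves.Rank1Residual
  Literature.NumberTheory.EllipticCurves.Rank1Residual.Typed
  Summit.BirchSwinnertonDyer.Rank1Residual
  Summit.BirchSwinnertonDyer.Rank1Residual.X11b
  Summit.BirchSwinnertonDyer.Rank1Residual.X11b.AcSelmer
  Summit.BirchSwinnertonDyer.BirchSwinnertonDyer.Theorems.SchneiderFree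
  Summit.BirchSwinnertonDyer.BirchSwinnertonDyer.Theorems.SchneiderFreeControlAtoms
  Summit.BirchSwinnertonDyer.BirchSwinnertonDyer.Theorems.SchneiderFreeAdditiveX3

set_option linter.dupNamespace false
set_option autoImplicit false

namespace Summit.BirchSwinnertonDyer.BirchSwinnertonDyer.Theorems.PrintCf2.EisensteinTwo

section AnyPrime

variable {W : WeierstrassCurve ℚ} [W.IsElliptic] [W.IsGloballyMinimal] {K : Type} [Field K]
  [NumberField K] {p : ℕ} [Fact p.Prime] {κ : ZpExtension K p}

/-- **The control exponent's correction IS the base count's correction (every prime, every `τ`).** Same data and atoms as bsd-schneider's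
`additiveControlOnTreeAt_of_torsAtoms` — `K` imaginary quadratic with `p` split and `p ∣ N_E`, `κ` anticyclotomic with topological generator `γ`,
`𝔭 ∣ p`, any `ι`, `P`; (KER-res) `#ker res = p^g`, (KER-𝔭) `#ker r_𝔭 = p^t`, (P9-𝓒) `hloc`, (L10) `h10`, (P11) `h11` — EXCEPT that the torsion-aware
base count (P6-add-tors) carries an extra integer correction `τ`: `#Sel_𝔭(K, E[p^∞]) = p^a`,
`a = ord_p #Ш(E/K)[p^∞] + 2(ord_p log_ω P − ord_p[E(K):ℤP]) + ord_p ∏_{w∣p} c_w(E/K) + g − t + τ`. CONCLUSION: `X_(∅,0)` at `𝔭` has a characteristic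
power series with `ord_p f(0) = n`, `n = ord_p #Ш(E/K)[p^∞] + 2(ord_p log_ω P − ord_p[E(K):ℤP]) + ord_p ∏_{w∣N⁺} c_w(E/K) + τ`. The proof is the
cell's glue verbatim (`g`, `t` cancel; `τ` rides through). [cite: JetchevSkinnerWan2017, Thm. 3.3.1 and Prop. 3.2.1 (arXiv:1512.06894 pp. 10–11)]
[cite: Castella2018, Thm. 2.3 (arXiv:1704.06608 p. 5)] -/
theorem hasCharValuationAt_of_torsAtoms_corr (hK : IsImaginaryQuadratic K) (hsplit : SplitsIn K p)
    (hpN : p ∣ W.conductorNorm ℤ) (hκ : κ.IsAnticyclotomic)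
    (γ : absoluteGaloisGroup K) [hγ : Fact (κ.IsTopGenerator γ)] (𝔭 : HeightOneSpectrum (𝓞 K))
    (h𝔭 : ((p : ℕ) : 𝓞 K) ∈ 𝔭.asIdeal) (ι : K →+* ℚ_[p]) (P : (W.baseChange K).toAffine.Point)
    (g t a : ℕ) (τ : ℤ)
    (hres : Nat.card ((W.baseChange K).resOfLe p (le_top : κ.kerSubgroup ≤ ⊤)).ker = p ^ g)
    (h𝔭ker : Nat.card (localKer κ.kerSubgroup ((W.baseChange K).geomPrimaryTorsion p) 𝔭) = p ^ t)
    (h6 : (∃ _ : Finite (selmerAcBase (W.baseChange K) p 𝔭 ∅),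
        Nat.card (selmerAcBase (W.baseChange K) p 𝔭 ∅) = p ^ a) ∧
      (a : ℤ) = (padicValNat p
          (Nat.card (AddCommGroup.primaryComponent (W.baseChange K).sha p)) : ℤ) +
        2 * (X11b.padicLogOrd W p ι P - (padicValNat p (AddSubgroup.zmultiples P).index : ℤ)) +
          padicValNat p (X11b.tamagawaProductAbove W K p) + g - t + τ)
    (hloc : ∀ x : Π v : ↥(insert 𝔭 (nPlusPlaces_finite (W := W) (p := p) (K := K) hK.1).toFinset),
        Literature.NumberTheory.EllipticCurves.subgroupH1
          ((⊤ : Subgroup (absoluteGaloisGroup K)) ⊓ decomp (v : HeightOneSpectrum (𝓞 K)))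
          ((W.baseChange K).geomPrimaryTorsion p),
      (∀ v : ↥(insert 𝔭 (nPlusPlaces_finite (W := W) (p := p) (K := K) hK.1).toFinset),
        x v ∈ localKer κ.kerSubgroup ((W.baseChange K).geomPrimaryTorsion p)
          (v : HeightOneSpectrum (𝓞 K))) →
        ∃ c : (W.baseChange K).subgroupH1 p (⊤ : Subgroup (absoluteGaloisGroup K)),
          locAtFinset (W.baseChange K) p _ c = x ∧
          ∀ v : HeightOneSpectrum (𝓞 K), ((p : ℕ) : 𝓞 K) ∉ v.asIdeal → v ∉ (∅ : Set _) →
            v ∉ insert 𝔭 (nPlusPlaces_finite (W := W) (p := p) (K := K) hK.1).toFinset →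
              c ∈ awayKer ⊤ ((W.baseChange K).geomPrimaryTorsion p) v)
    (h10 : X11b.CoinvariantsTrivialAt (W.baseChange K) p κ 𝔭 γ)
    (h11 : ∀ v ∈ nPlusPlaces W K p, X11b.LocalKernelOrderAt (W.baseChange K) p κ v) :
    ∃ n : ℕ, XAc.HasCharValuationAt (W.baseChange K) p κ 𝔭 ∅ γ n ∧
      (n : ℤ) = (padicValNat p (Nat.card (AddCommGroup.primaryComponent (W.baseChange K).sha p)) : ℤ) +
        2 * (X11b.padicLogOrd W p ι P - (padicValNat p (AddSubgroup.zmultiples P).index : ℤ)) +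
          padicValNat p (X11b.tamagawaProductSplit W K) + τ := by
  have hp : p.Prime := Fact.out
  haveI : IsTotallyComplex K := hK.2
  obtain ⟨⟨hfinK, hcardK⟩, ha⟩ := h6
  haveI := hfinK
  have hfin𝔭 : Finite (localKer κ.kerSubgroup ((W.baseChange K).geomPrimaryTorsion p) 𝔭) :=
    Nat.finite_of_card_ne_zero (by rw [h𝔭ker]; exact pow_ne_zero _ hp.ne_zero)
  have hfin : ∀ v ∈ nPlusPlaces W K p,
      Finite (localKer κ.kerSubgroup ((W.baseChange K).geomPrimaryTorsion p) v) :=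
    fun v hv ↦ (h11 v hv).1
  obtain ⟨hfinγ, _, hcount⟩ := natCard_endInvariants_mul_natCard_resKer_eq_nPlus (W := W) hK hκ γ 𝔭
    h𝔭 hfin𝔭 hfin hloc
  -- the local kernels at `Σ(N⁺)` are the Tamagawa `p`-parts
  have hprod : (∏ v ∈ (nPlusPlaces_finite (W := W) (p := p) (K := K) hK.1).toFinset,
      Nat.card (localKer κ.kerSubgroup ((W.baseChange K).geomPrimaryTorsion p) v)) =
        p ^ ∑ v ∈ (nPlusPlaces_finite (W := W) (p := p) (K := K) hK.1).toFinset, padicValNat p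
          (((W.baseChange K).baseChange (v.adicCompletion K)).localTamagawaNumber
            (v.adicCompletionIntegers K)) := by
    rw [← Finset.prod_pow_eq_pow_sum]
    refine Finset.prod_congr rfl fun v hv => ?_
    obtain ⟨_, hv'⟩ := h11 v ((nPlusPlaces_finite (W := W) (p := p) hK.1).mem_toFinset.mp hv)
    exact hv'
  rw [hres, hcardK, h𝔭ker, hprod, ← pow_add, ← pow_add] at hcount
  -- `#Sel^γ · p^g = p^m`, `m = a + (t + Σ ord_p c_w)`, hence `#Sel^γ = p^(m - g)`
  obtain ⟨m, hm, hcount⟩ : ∃ m : ℕ, m = a + (t + ∑ v ∈ (nPlusPlaces_finite (W := W) (p := p)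
      (K := K) hK.1).toFinset, padicValNat p
        (((W.baseChange K).baseChange (v.adicCompletion K)).localTamagawaNumber
          (v.adicCompletionIntegers K))) ∧
      Nat.card (IwasawaDual.endInvariants (conjSelmerAc (W.baseChange K) p κ 𝔭 ∅ γ - 1)) * p ^ g =
        p ^ m := ⟨_, rfl, hcount⟩
  have hle : g ≤ m := by
    have hdvd : p ^ g ∣ p ^ m := ⟨_, by rw [mul_comm]; exact hcount.symm⟩
    exact (Nat.pow_dvd_pow_iff_le_right hp.one_lt).mp hdvd
  have hcardγ : Nat.card (IwasawaDual.endInvariants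
      (conjSelmerAc (W.baseChange K) p κ 𝔭 ∅ γ - 1)) = p ^ (m - g) := by
    have hsplitpow : p ^ m = p ^ (m - g) * p ^ g := by
      rw [← pow_add, Nat.sub_add_cancel hle]
    rw [hsplitpow] at hcount
    exact Nat.eq_of_mul_eq_mul_right (pow_pos hp.pos g) hcount
  have hcoinv := X11b.natCard_endCoinvariants_eq_one_of_surjective _ h10
  haveI := X11b.module_finite_XAc_baseChange p κ 𝔭 γ (W := W)
  refine ⟨m - g, ?_, ?_⟩
  · rw [XAc.hasCharValuationAt_iff_card]
    exact ⟨hfinγ, by rw [hcardγ, hcoinv, mul_one]⟩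
  · rw [Nat.cast_sub hle, hm, Nat.cast_add, Nat.cast_add, ha,
      X11b.padicValNat_tamagawaProductSplit_eq_above_add_sum W p hK.1 hsplit hpN]
    push_cast
    ring

end AnyPrime

/-! ## `p = 2`, `τ = 1`: the registered `stub_control_two` at one frame from the atoms with the base count corrected by `+1` -/

section Two

variable {W : WeierstrassCurve ℚ} [W.IsElliptic] [W.IsGloballyMinimal] {K : Type} [Field K]
  [NumberField K] {κ : ZpExtension K 2}

/-- **D2a LOCALISED (`p = 2`).** At a datum of the line (`K` imaginary quadratic, `2` split, `2 ∣ N_W`, `κ` anticyclotomic with topological generator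
`γ`, `𝔭′ ∣ 2`, `P ∈ E(K)`): IF (KER-res) `#ker(H¹(K, W[2^∞]) → H¹(K_∞, W[2^∞])) = 2^g`, (KER-𝔭′) `#ker r_𝔭′ = 2^t`, **(P6-add-tors)₊₁ Castella's base
Selmer group `Sel_𝔭′(K, W[2^∞])` has order `2^a` with `a = ord₂ #Ш(E_K)[2^∞] + 2(ord₂ log_ω P − ord₂ [E(K):ℤP]) + ord₂ ∏_{w∣2} c_w(E_K) + g − t + 1`**,
(P9-𝓒), (L10), (P11) hold, THEN the conclusion of the REGISTERED `stub_control_two` holds at this frame: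
`∃ n, XAc.HasCharValuationAt (W.baseChange K) 2 κ 𝔭′ ∅ γ n ∧ n = ord₂ #Ш(E_K)[2^∞] + 2(padicLogOrd − ord₂ [E(K):ℤP]) + ord₂ ∏_{w∣N⁺} c_w + 1`.
So the research content of `stub_control_two` beyond bsd-schneider's prime-free glue and odd-`p`-shaped atoms is ONE number: the `+1` in the base
count at `2`. CONDITIONAL on the atoms; nothing here asserts them. [cite: JetchevSkinnerWan2017, Prop. 3.2.1 and Thm. 3.3.1 (arXiv:1512.06894 pp. 10–11)]
[cite: Castella2018, Thm. 2.3 (arXiv:1704.06608 p. 5)] -/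
theorem controlTwo_of_torsAtoms (hK : IsImaginaryQuadratic K) (hsplit : SplitsIn K 2)
    (h2N : 2 ∣ W.conductorNorm ℤ) (hκ : κ.IsAnticyclotomic)
    (γ : absoluteGaloisGroup K) [hγ : Fact (κ.IsTopGenerator γ)] (𝔭' : HeightOneSpectrum (𝓞 K))
    (h𝔭' : ((2 : ℕ) : 𝓞 K) ∈ 𝔭'.asIdeal) (he' : 𝔭'.asIdeal.ramificationIdx (𝓞 ℚ) = 1)
    (hf' : 𝔭'.asIdeal.inertiaDeg (𝓞 ℚ) = 1) (P : (W.baseChange K).toAffine.Point)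
    (g t a : ℕ)
    (hres : Nat.card ((W.baseChange K).resOfLe 2 (le_top : κ.kerSubgroup ≤ ⊤)).ker = 2 ^ g)
    (h𝔭ker : Nat.card (localKer κ.kerSubgroup ((W.baseChange K).geomPrimaryTorsion 2) 𝔭') = 2 ^ t)
    (h6 : (∃ _ : Finite (selmerAcBase (W.baseChange K) 2 𝔭' ∅),
        Nat.card (selmerAcBase (W.baseChange K) 2 𝔭' ∅) = 2 ^ a) ∧
      (a : ℤ) = (padicValNat 2
          (Nat.card (AddCommGroup.primaryComponent (W.baseChange K).sha 2)) : ℤ) +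
        2 * (X11b.padicLogOrd W 2 (embAt K 2 𝔭' h𝔭' he' hf') P - (padicValNat 2 (AddSubgroup.zmultiples P).index : ℤ)) +
          padicValNat 2 (X11b.tamagawaProductAbove W K 2) + g - t + 1)
    (hloc : ∀ x : Π v : ↥(insert 𝔭' (nPlusPlaces_finite (W := W) (p := 2) (K := K) hK.1).toFinset),
        Literature.NumberTheory.EllipticCurves.subgroupH1
          ((⊤ : Subgroup (absoluteGaloisGroup K)) ⊓ decomp (v : HeightOneSpectrum (𝓞 K)))
          ((W.baseChange K).geomPrimaryTorsion 2),
      (∀ v : ↥(insert 𝔭' (nPlusPlaces_finite (W := W) (p := 2) (K := K) hK.1).toFinset),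
        x v ∈ localKer κ.kerSubgroup ((W.baseChange K).geomPrimaryTorsion 2)
          (v : HeightOneSpectrum (𝓞 K))) →
        ∃ c : (W.baseChange K).subgroupH1 2 (⊤ : Subgroup (absoluteGaloisGroup K)),
          locAtFinset (W.baseChange K) 2 _ c = x ∧
          ∀ v : HeightOneSpectrum (𝓞 K), ((2 : ℕ) : 𝓞 K) ∉ v.asIdeal → v ∉ (∅ : Set _) →
            v ∉ insert 𝔭' (nPlusPlaces_finite (W := W) (p := 2) (K := K) hK.1).toFinset →
              c ∈ awayKer ⊤ ((W.baseChange K).geomPrimaryTorsion 2) v)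
    (h10 : X11b.CoinvariantsTrivialAt (W.baseChange K) 2 κ 𝔭' γ)
    (h11 : ∀ v ∈ nPlusPlaces W K 2, X11b.LocalKernelOrderAt (W.baseChange K) 2 κ v) :
    ∃ n : ℕ, XAc.HasCharValuationAt (W.baseChange K) 2 κ 𝔭' ∅ γ n ∧
      (n : ℤ) = (padicValNat 2 (Nat.card (AddCommGroup.primaryComponent (W.baseChange K).sha 2)) : ℤ) +
        2 * (X11b.padicLogOrd W 2 (embAt K 2 𝔭' h𝔭' he' hf') P - (padicValNat 2 (AddSubgroup.zmultiples P).index : ℤ)) +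
          padicValNat 2 (X11b.tamagawaProductSplit W K) + 1 :=
  hasCharValuationAt_of_torsAtoms_corr hK hsplit h2N hκ γ 𝔭' h𝔭' (embAt K 2 𝔭' h𝔭' he' hf') P g t a 1 hres h𝔭ker h6 hloc h10 h11

end Two

end Summit.BirchSwinnertonDyer.BirchSwinnertonDyer.Theorems.PrintCf2.EisensteinTwo

end
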